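import Summits.QuantumFields.BalabanUV.T4Continuum.Support.InsertionChannelFamily
import Summits.QuantumFields.BalabanUV.T4Continuum.Support.NE9Lemma1Gain
import Summits.QuantumFields.BalabanUV.T4Continuum.Support.OutputRateCount124

/-!
# InsertionChannelFamilyPiece — the channel road CARRIED TO ROAD D, part 2: the per-chart-point MI-3a binder of leaf-02's
# per-background slots AT PRINT's LETTERS for the PIECE FORM of [II] (1.23)∕(1.33) (`NE9Lemma1Counting.pieceChannel`, the pieces
# reading the earlier term AS A FUNCTION OF THE BACKGROUND), the END over the ORIGINAL carriers, and a TOY over an INFINITE chart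
# witnessing both the non-vacuity of part 1's discharge and the located design fact D-ne5leaf06g12-1
# (cell `pub-balaban`, T⁴ fan-out; row NE5, node U3; `HOME/t4/formal/NE5/LEAVES.md` row O1-c follower; INTENT l.17278)

Unit `b2b-balaban-t4-ne5-formalise-leaf-06` (NE5 formalisation swarm, leaf prover 06, gen 12).  Summits-side NEW WORK under the
LEAN PLACEMENT RULE (cell modelling + bookkeeping over ABSTRACT carriers; nothing of the manuscripts under audit is asserted; 0 cite
tags; no `Prop`-valued fact minted — trigger c3).  HONEST FRAMING: rung (B)+1 of the FINITE-VOLUME T⁴ continuum programme — NOT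
infinite volume, NOT a mass gap, NOT the Clay problem, NOT a proof of NE5 (NOT PRINTED; cell GAPS G-t4-U3-1) nor of NE9; spine 0/9;
0/12 leaves instantiated on Bałaban's concrete objects (O1 = the substrate cell, owner R34).  HONEST DEPENDENCY (cell line,
verbatim): continuum YM on T⁴ ⇐ BetaPertH ∧ nine spine estimates (0/9 proved); BetaPertH ⇐ (D1) ∧ (D4) ∧ CAP+tail; G-an2-4 gates
asym, D1 and NE2/3/4.

WHAT THIS FILE TYPES ([folklore] bookkeeping on part 1 `InsertionChannelFamily`; 0 sorry; row NE9's shapes enter BY NAME as displayed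
hypotheses, none is discharged here):
* §1 for leaf-02's `PointwiseSlots P` whose run-A insertion IS `insAtOfChannel (pieceChannel Pc) out` (the piece data `Pc` over `C`
  with background index `𝒰` — on Road D the function table `t : C.Dom × 𝒰 → ℝ` IS the pieces' background family, `toBgFamily t`):
  the per-point `hdamp` in Nat form at `c = (6L)⁴`, `ω = L⁻¹` (`insertionDampedNat_pointwise_of_insAt_piece`: `SrcScale`, the
  (1.24)×(1.25)-SHAPE `PieceBound`, the p. 8 `LevelCounts`, signs, the weight dictionary for `weightOf` —
  `channelSizeAtStepNN_piece_printed`, `channelAdditive_piece`, `channelStepSum_piece` BY NAME), in the kernel's C0 normalisation with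
  gain `(6L)⁴·L` (`insertionDamped_pointwise_of_insAt_piece` = EXACTLY the `hdamp` hypothesis of `PointwiseSlots.ne5_of_pointwiseSlots`),
  at the GAIN-PARAMETRIC letters `cQ, ω` of row NE9's kernel currency (`…_pieceG`: `PieceBoundG` + `LevelCountsG … (agePow ω)`,
  `NE9Lemma1Gain.channelSizeAtStepNN_pieceG_profile`), and at model level `insertionDampedNat_of_insAt_piece :
  P.toStepModel.InsertionDampedNat W κ ((6L)⁴) L⁻¹` (the `hdamp` of the owner's `OutputRateCount124.ne5_at_of_stepModel_lip_count124_nat`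
  for the family model over `paramCarriers C 𝒰`).
* §2 ENDs OVER THE ORIGINAL CARRIERS: `ne5_of_pointwiseSlots_pieceChannel` = leaf-02's Road-D END `ne5_of_pointwiseSlots` (p225051)
  with its displayed `hdamp` REPLACED by (the insertion IS the piece channel's + `SrcScale` + `PieceBound` + `LevelCounts` + signs +
  weight dictionary), every other hypothesis VERBATIM — conclusion LITERALLY `T4OutputRate.NE5 EA EB W κ θ C₅`, C0's constant at
  `c = (6L)⁴·L`, `ω = L⁻¹`; and `ne5_of_pointwiseSlots_pieceChannel_lip_nat` = the owner's C1 face AT THE PRINTED-COUNT LETTERS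
  `OutputRateCount124.ne5_at_of_stepModel_lip_count124_nat` on `P.toStepModel` (representation ∕ admissibility ∕ W1 ∕ insertion rate
  from their per-point forms by leaf-02's part-3 transfers, W2 as the model-level `DataLipschitz` binder displayed, `hdamp` from §1)
  followed by `ne5_of_ne5_lift` — conclusion LITERALLY `T4OutputRate.NE5 EA EB W κ θ′ ((Λ(δ+δ′)+B)(θ′−L⁻¹)∕(θ′−(L⁻¹+Λ(6L)⁴)))`, the
  constant of `InsertionChannelEnd.ne5_at_of_stepModel_fibre_pieceChannel_nat`'s C1 parent character for character.
* §3 TOY OVER THE INFINITE CHART `ℕ` on the kernel's `toyCarriers` (`toyFrame`: one entry per domain, unit formats; `toyChannel`: the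
  output index `(n, u)` reads the family AT the background `u` and domain `n ≤ k` — everywhere additive, local, unit size binder;
  `toySlots`: per-background slots whose insertions ARE `insAtOfChannel toyChannel toyOut`): (i) NON-VACUITY — part 1's hypotheses hold
  jointly and `toySlots.toStepModel.InsertionDampedNat univ 0 1 1` is DISCHARGED by part 1 (`toySlots_insertionDampedNat`); (ii) THE
  LOCATED DESIGN FACT, KERNEL-CHECKED — at step 1 every chart point's inserted history is faithful with norm EXACTLY `|t (0, u)|`
  (`toy_norm_insAt_eq`), so the chart-unbounded table `tBad (n, u) := u` has an unbounded family of faithful histories and the family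
  model inserts it as the junk `0` (`toy_model_insA_tBad`), and **`toy_not_insAffine : ¬ toySlots.toStepModel.InsAffine univ`** (the
  mixed-junk pair `tBad`, `tBad − tOne`) and **`toy_not_readsFamily`** (the exact family-level reading fails at `tBad`, chart point `1`,
  entry `0`) — while MI-3a holds: on Road D the channel road's socket is the INEQUALITY binder.
NOT IN THIS FILE.  No instance on Bałaban's objects; no NE9 binder discharged (`PieceBound[G]`, `LevelCounts[G]`, `SrcScale` displayed —
row NE9's); no W1 ∕ W2; no estimate of [II].  Headline wording (owner R30 (ii) ∕ R35): «NE5 channel road (L09 ∕ MI-3a READ FROM row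
NE9's S5) carried to Road D — junction only»; never «leaf instantiated».  NE5 NOT PROVED; NE9 NOT PROVED; spine 0/9; rung (B)+1
finite T⁴; NOT infinite volume ∕ mass gap ∕ Clay.  Axioms ⊆ {propext, Classical.choice, Quot.sound}.
-/

noncomputable section

open scoped BigOperators
open Finset Function Metric Set

namespace Summit.QuantumFields.BalabanUV.T4Continuum.InsertionChannelFamily

open Literature.MathematicalPhysics.QuantumFieldTheory.Balaban1983to89
open Literature.MathematicalPhysics.QuantumFieldTheory.Balaban1983to89.T4OutputRate (Carriers Functional DecayBound NE5)
open Literature.MathematicalPhysics.QuantumFieldTheory.Balaban1983to89.T4InputCauchyRate (toyCarriers)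
open Literature.MathematicalPhysics.QuantumFieldTheory.Balaban1983to89.T4InputCauchyRateData (StepModel mul_sum_age_shift)
open Literature.MathematicalPhysics.QuantumFieldTheory.Balaban1983to89.T4HistoryLipschitzRecursion
  (ChannelAdditive ChannelLocal ChannelStepSum ChannelSizeAtStepNN truncScale channelStepSum_of_local)
open Summit.QuantumFields.BalabanUV.T4Continuum.B13HistDatum (HistFrame Hist)
open Summit.QuantumFields.BalabanUV.T4Continuum.NE9Lemma1Counting (PieceData pieceChannel SrcScale PieceBound LevelCounts weightOf
  channelAdditive_piece channelStepSum_piece channelSizeAtStepNN_piece_printed ellPrinted)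
open Summit.QuantumFields.BalabanUV.T4Continuum.NE9Lemma1Gain (PieceBoundG LevelCountsG agePow channelSizeAtStepNN_pieceG_profile)
open Summit.QuantumFields.BalabanUV.T4Continuum.InsertionChannelReading (weightOf_nonneg)
open Summit.QuantumFields.BalabanUV.T4Continuum.OutputRateFunctionalTables
open Summit.QuantumFields.BalabanUV.T4Continuum.OutputRateFunctionalTablesFamily (Fam famOf famOf_apply famOf_eq_zero toBgFamily)
open Summit.QuantumFields.BalabanUV.T4Continuum.OutputRateFunctionalTablesPointwise (PointwiseSlots)

variable {C : Carriers} {𝒰 ι : Type} {F : HistFrame C}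

/-! ## §1 The piece form of [II] (1.23)∕(1.33): `hdamp` at print's letters and at the gain-parametric letters -/

section Piece

variable {α β γ : Type} {Op : Type*} [NormedAddCommGroup Op] [NormedSpace ℂ Op] (P : PointwiseSlots C 𝒰 Op (Hist F))
  {Pc : PieceData C 𝒰 ι α β γ} {out : 𝒰 → F.Idx → ι} {W : Set (ℕ → ℝ)}

/-- [folklore] **`hdamp` (Nat form) AT PRINT's LETTERS `c = (6L)⁴`, `ω = L⁻¹` FOR SLOTS READING THE PIECE FORM** — the pieces
`Pc.piece … x : (𝒰 → ℝ) →+ ℝ` read the earlier term at the source `x` AS A FUNCTION OF THE BACKGROUND (Road D's currency); inputs: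
the insertion IS `insAtOfChannel (pieceChannel Pc) out`, `SrcScale`, the (1.24)×(1.25)-SHAPE `PieceBound` and the p. 8 `LevelCounts`
(row NE9's displayed binders, NOT proved here), the signs, and the weight dictionary for the counting weight `weightOf`
(`channelSizeAtStepNN_piece_printed`, `channelAdditive_piece`, `channelStepSum_piece` BY NAME). -/
theorem insertionDampedNat_pointwise_of_insAt_piece {κ κ₁ d0 O1 L : ℝ} {Kp : ℕ → ι → ℝ}
    (hins : ∀ k, ∀ g ∈ W, ∀ (t : C.Dom × 𝒰 → ℝ) (u : 𝒰), P.insA g k t u = insAtOfChannel (pieceChannel Pc) out g k t u)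
    (hsrc : SrcScale Pc) (hL : 1 < L) (hPiece : PieceBound Pc κ κ₁ d0 Kp (ellPrinted L))
    (hLev : LevelCounts Pc κ κ₁ O1 L (ellPrinted L)) (hKp : ∀ k y, 0 ≤ Kp k y) (hO1 : 0 ≤ O1)
    (hwt : ∀ k u i, weightOf Pc κ₁ d0 O1 Kp k (out u i) ≤ P.rHist (k + 1) * F.wt i) :
    ∀ k, ∀ g ∈ W, ∀ (t t' : C.Dom × 𝒰 → ℝ) (D : ℕ → ℝ), (∀ j < k, 0 ≤ D j) →
      (∀ Y, C.scale Y < k → ∀ u, |t (Y, u) - t' (Y, u)| ≤ D (C.scale Y) * Real.exp (-(κ * C.d Y))) →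
        ∀ u, ‖P.insA g k t u - P.insA g k t' u‖ ≤ P.rHist k * ((6 * L) ^ 4 * ∑ j ∈ range k, L⁻¹ ^ (k - 1 - j) * D j) := by
  obtain ⟨hsize, hprof, hω, -⟩ := channelSizeAtStepNN_piece_printed hL hsrc hPiece hLev hKp hO1 (Set.univ : Set (𝒰 → C.Dom → ℝ))
  exact insertionDampedNat_pointwise_of_insAt P hins (channelAdditive_piece Pc _) (channelStepSum_piece hsrc _) hsize
    (fun k u i => weightOf_nonneg hKp hO1 k (out u i)) hwt hprof (by positivity) hω

/-- [folklore] **`hdamp` IN C0's NORMALISATION AT PRINT's LETTERS** — gain `(6L)⁴·L`, weights `(L⁻¹)^{k−j}`: EXACTLY the `hdamp`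
hypothesis of `PointwiseSlots.ne5_of_pointwiseSlots` with `c := (6L)⁴·L`, `ω := L⁻¹`. -/
theorem insertionDamped_pointwise_of_insAt_piece {κ κ₁ d0 O1 L : ℝ} {Kp : ℕ → ι → ℝ}
    (hins : ∀ k, ∀ g ∈ W, ∀ (t : C.Dom × 𝒰 → ℝ) (u : 𝒰), P.insA g k t u = insAtOfChannel (pieceChannel Pc) out g k t u)
    (hsrc : SrcScale Pc) (hL : 1 < L) (hPiece : PieceBound Pc κ κ₁ d0 Kp (ellPrinted L))
    (hLev : LevelCounts Pc κ κ₁ O1 L (ellPrinted L)) (hKp : ∀ k y, 0 ≤ Kp k y) (hO1 : 0 ≤ O1)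
    (hwt : ∀ k u i, weightOf Pc κ₁ d0 O1 Kp k (out u i) ≤ P.rHist (k + 1) * F.wt i) :
    ∀ k, ∀ g ∈ W, ∀ (t t' : C.Dom × 𝒰 → ℝ) (D : ℕ → ℝ), (∀ j < k, 0 ≤ D j) →
      (∀ Y, C.scale Y < k → ∀ u, |t (Y, u) - t' (Y, u)| ≤ D (C.scale Y) * Real.exp (-(κ * C.d Y))) →
        ∀ u, ‖P.insA g k t u - P.insA g k t' u‖ ≤ P.rHist k * ((6 * L) ^ 4 * L * ∑ j ∈ range k, L⁻¹ ^ (k - j) * D j) := by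
  intro k g hg t t' D hD hb u
  have hL0 : 0 < L := by linarith
  have h := insertionDampedNat_pointwise_of_insAt_piece P hins hsrc hL hPiece hLev hKp hO1 hwt k g hg t t' D hD hb u
  rw [mul_sum_age_shift (inv_pos.2 hL0).ne', div_inv_eq_mul] at h
  exact h

/-- [folklore] **`hdamp` (Nat form) AT THE GAIN-PARAMETRIC LETTERS `cQ, ω`** (row NE9's kernel currency of record: `PieceBoundG` +
`LevelCountsG … (agePow ω)`, `channelSizeAtStepNN_pieceG_profile` BY NAME; print: `gain = (Lʲη)^{4+α}`, `cQ = (6L)⁴`, `ω = L^{−α}`). -/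
theorem insertionDampedNat_pointwise_of_insAt_pieceG {κ κ₁ d0 O1 cQ ω : ℝ} {Kp : ℕ → ι → ℝ} {gain : ℕ → ℕ → ℝ}
    (hins : ∀ k, ∀ g ∈ W, ∀ (t : C.Dom × 𝒰 → ℝ) (u : 𝒰), P.insA g k t u = insAtOfChannel (pieceChannel Pc) out g k t u)
    (hsrc : SrcScale Pc) (hPiece : PieceBoundG Pc κ κ₁ d0 Kp gain) (hLev : LevelCountsG Pc κ κ₁ O1 cQ gain (agePow ω))
    (hKp : ∀ k y, 0 ≤ Kp k y) (hO1 : 0 ≤ O1) (hgain : ∀ k j, 0 ≤ gain k j) (hcQ : 0 ≤ cQ) (hω : 0 ≤ ω)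
    (hwt : ∀ k u i, weightOf Pc κ₁ d0 O1 Kp k (out u i) ≤ P.rHist (k + 1) * F.wt i) :
    ∀ k, ∀ g ∈ W, ∀ (t t' : C.Dom × 𝒰 → ℝ) (D : ℕ → ℝ), (∀ j < k, 0 ≤ D j) →
      (∀ Y, C.scale Y < k → ∀ u, |t (Y, u) - t' (Y, u)| ≤ D (C.scale Y) * Real.exp (-(κ * C.d Y))) →
        ∀ u, ‖P.insA g k t u - P.insA g k t' u‖ ≤ P.rHist k * (cQ * ∑ j ∈ range k, ω ^ (k - 1 - j) * D j) := by
  obtain ⟨hsize, hprof, -, -⟩ :=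
    channelSizeAtStepNN_pieceG_profile hsrc hPiece hLev hKp hO1 hgain hcQ hω (Set.univ : Set (𝒰 → C.Dom → ℝ))
  exact insertionDampedNat_pointwise_of_insAt P hins (channelAdditive_piece Pc _) (channelStepSum_piece hsrc _) hsize
    (fun k u i => weightOf_nonneg hKp hO1 k (out u i)) hwt hprof hcQ hω

/-- [folklore] **MODEL LEVEL AT PRINT's LETTERS**: `P.toStepModel.InsertionDampedNat W κ ((6L)⁴) L⁻¹` — the `hdamp` binder of the
owner's `OutputRateCount124.ne5_at_of_stepModel_lip_count124_nat` for the family model over `paramCarriers C 𝒰` (nonempty chart). -/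
theorem insertionDampedNat_of_insAt_piece [Nonempty 𝒰] {κ κ₁ d0 O1 L : ℝ} {Kp : ℕ → ι → ℝ}
    (hins : ∀ k, ∀ g ∈ W, ∀ (t : C.Dom × 𝒰 → ℝ) (u : 𝒰), P.insA g k t u = insAtOfChannel (pieceChannel Pc) out g k t u)
    (hsrc : SrcScale Pc) (hL : 1 < L) (hPiece : PieceBound Pc κ κ₁ d0 Kp (ellPrinted L))
    (hLev : LevelCounts Pc κ κ₁ O1 L (ellPrinted L)) (hKp : ∀ k y, 0 ≤ Kp k y) (hO1 : 0 ≤ O1)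
    (hwt : ∀ k u i, weightOf Pc κ₁ d0 O1 Kp k (out u i) ≤ P.rHist (k + 1) * F.wt i) :
    P.toStepModel.InsertionDampedNat W κ ((6 * L) ^ 4) L⁻¹ := by
  obtain ⟨hsize, hprof, hω, -⟩ := channelSizeAtStepNN_piece_printed hL hsrc hPiece hLev hKp hO1 (Set.univ : Set (𝒰 → C.Dom → ℝ))
  exact insertionDampedNat_of_insAt P hins (channelAdditive_piece Pc _) (channelStepSum_piece hsrc _) hsize
    (fun k u i => weightOf_nonneg hKp hO1 k (out u i)) hwt hprof (by positivity) hω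

/-! ## §2 END over the ORIGINAL carriers: leaf-02's `ne5_of_pointwiseSlots` with `hdamp` read from the piece channel -/

/-- [folklore] **NE5 OVER `C` FOR PER-BACKGROUND SLOTS WHOSE RUN-A INSERTION IS THE PIECE CHANNEL's** — leaf-02's Road-D END
`PointwiseSlots.ne5_of_pointwiseSlots` (p225051) with its displayed `hdamp` REPLACED by: the insertion IS `insAtOfChannel (pieceChannel Pc) out`
on `W`, `SrcScale`, `PieceBound`, `LevelCounts` (row NE9's displayed binders), the signs and the weight dictionary; every other hypothesis
VERBATIM (representation of the two runs' function tables at every chart point with the two inserted families of record bounded over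
the chart, admissibility, the pointwise output envelope, the decay bounds over `C`, the pointwise operator and insertion rates, the
kernel's smallness at `c = (6L)⁴·L`, `ω = L⁻¹`); conclusion `T4OutputRate.NE5 EA EB W κ θ C₅` LITERALLY, C0's constant. -/
theorem ne5_of_pointwiseSlots_pieceChannel [Nonempty 𝒰] {ρ : 𝒰 → C.BgB} (hρ : Surjective ρ) {EA : Functional C C.BgA}
    {EB : Functional C C.BgB} {κ κ₁ d0 O1 L G E₀ δ δ' θ : ℝ} {Kp : ℕ → ι → ℝ}
    (hbdA : ∀ g ∈ W, ∀ k, BddAbove (Set.range fun u => ‖P.insA g k (uncurry (funTableA ρ EA g)) u‖))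
    (hbdB : ∀ g ∈ W, ∀ k, BddAbove (Set.range fun u => ‖P.insB g k (uncurry (funTableB ρ EB g)) u‖))
    (hrA : ∀ g ∈ W, ∀ (X : C.Dom) (u : 𝒰), EA g (C.transport (ρ u)) X =
      (P.Out (C.scale X) (P.opA g (C.scale X) u) (P.insA g (C.scale X) (uncurry (funTableA ρ EA g)) u) X).re)
    (hrB : ∀ g ∈ W, ∀ (X : C.Dom) (u : 𝒰), EB g (ρ u) X =
      (P.Out (C.scale X) (P.opB g (C.scale X) u) (P.insB g (C.scale X) (uncurry (funTableB ρ EB g)) u) X).re)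
    (hbase : ∀ k, ∀ g ∈ W, ∀ u, (P.opB g k u, P.insB g k (uncurry (funTableB ρ EB g)) u) ∈ P.Base k g u)
    (henv : ∀ k, ∀ g ∈ W, ∀ u, ∀ q ∈ P.Base k g u, ∀ X : C.Dom, C.scale X = k →
      DifferentiableOn ℂ (fun z : Op × Hist F => P.Out k z.1 z.2 X) (closedBall q.1 (P.rOp k) ×ˢ closedBall q.2 (P.rHist k)) ∧
        ∀ z ∈ closedBall q.1 (P.rOp k) ×ˢ closedBall q.2 (P.rHist k), ‖P.Out k z.1 z.2 X‖ ≤ G * Real.exp (-(κ * C.d X)))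
    (hdA : DecayBound EA W G κ) (hdB : DecayBound EB W E₀ κ) (hE₀ : E₀ ≤ G)
    (hop : ∀ k, ∀ g ∈ W, ∀ u : 𝒰, ‖P.opA g k u - P.opB g k u‖ ≤ δ * θ ^ k * P.rOp k)
    (hinsRate : ∀ k, ∀ g ∈ W, ∀ (t : C.Dom × 𝒰 → ℝ), (∀ Y u, |t (Y, u)| ≤ E₀ * Real.exp (-(κ * C.d Y))) →
      ∀ u, ‖P.insA g k t u - P.insB g k t u‖ ≤ δ' * θ ^ k * P.rHist k)
    (hins : ∀ k, ∀ g ∈ W, ∀ (t : C.Dom × 𝒰 → ℝ) (u : 𝒰), P.insA g k t u = insAtOfChannel (pieceChannel Pc) out g k t u)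
    (hsrc : SrcScale Pc) (hL : 1 < L) (hPiece : PieceBound Pc κ κ₁ d0 Kp (ellPrinted L))
    (hLev : LevelCounts Pc κ κ₁ O1 L (ellPrinted L)) (hKp : ∀ k y, 0 ≤ Kp k y) (hO1 : 0 ≤ O1)
    (hwt : ∀ k u i, weightOf Pc κ₁ d0 O1 Kp k (out u i) ≤ P.rHist (k + 1) * F.wt i) (hG : 0 ≤ G) (hδ : 0 ≤ δ + δ')
    (hsmall : (1 + 4 * G * ((6 * L) ^ 4 * L)) * L⁻¹ < θ) :
    NE5 EA EB W κ θ (4 * G * (δ + δ') * (θ - L⁻¹) / (θ - (1 + 4 * G * ((6 * L) ^ 4 * L)) * L⁻¹)) :=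
  have hL0 : 0 < L := by linarith
  P.ne5_of_pointwiseSlots hρ hbdA hbdB hrA hrB hbase henv hdA hdB hE₀ hop hinsRate
    (insertionDamped_pointwise_of_insAt_piece P hins hsrc hL hPiece hLev hKp hO1 hwt) hG hδ (by positivity) (inv_pos.2 hL0).le
    hsmall

/-- [folklore] **NE5 OVER `C`, C1 AT THE PRINTED-COUNT LETTERS, FOR PER-BACKGROUND SLOTS READING THE PIECE CHANNEL** — the owner's
`OutputRateCount124.ne5_at_of_stepModel_lip_count124_nat` on the family model `P.toStepModel` over `paramCarriers C 𝒰` with: the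
representation of the two runs' function tables, admissibility, W1 and the insertion rate from their PER-POINT forms (leaf-02's part-3
transfers `representsA∕B_of_pointwise`, `inBase_of_pointwise`, `operatorRate_of_pointwise`, `insertionRate_of_pointwise`), W2 as the
DISPLAYED model-level joint binder `DataLipschitz W κ Λ ρ₀`, the decay bounds over `C` lifted, and `hdamp := insertionDampedNat_of_insAt_piece`
(§1: the insertion IS the piece channel's + row NE9's displayed binders + weight dictionary); then `ne5_of_ne5_lift` (chart onto, nonempty).
Smallness in the explicit Λ-form `Λ < (θ′ − L⁻¹)∕(6L)⁴` (owner R30 (iii)). -/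
theorem ne5_of_pointwiseSlots_pieceChannel_lip_nat [Nonempty 𝒰] {ρ : 𝒰 → C.BgB} (hρ : Surjective ρ) {EA : Functional C C.BgA}
    {EB : Functional C C.BgB} {κ κ₁ d0 O1 L Λ EA₀ E₀ δ δ' θ θ' ρ₀ B : ℝ} {k₀ : ℕ} {Kp : ℕ → ι → ℝ} (hL : 1 < L)
    (hbdA : ∀ g ∈ W, ∀ k, BddAbove (Set.range fun u => ‖P.insA g k (uncurry (funTableA ρ EA g)) u‖))
    (hbdB : ∀ g ∈ W, ∀ k, BddAbove (Set.range fun u => ‖P.insB g k (uncurry (funTableB ρ EB g)) u‖))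
    (hrA : ∀ g ∈ W, ∀ (X : C.Dom) (u : 𝒰), EA g (C.transport (ρ u)) X =
      (P.Out (C.scale X) (P.opA g (C.scale X) u) (P.insA g (C.scale X) (uncurry (funTableA ρ EA g)) u) X).re)
    (hrB : ∀ g ∈ W, ∀ (X : C.Dom) (u : 𝒰), EB g (ρ u) X =
      (P.Out (C.scale X) (P.opB g (C.scale X) u) (P.insB g (C.scale X) (uncurry (funTableB ρ EB g)) u) X).re)
    (hbase : ∀ k, ∀ g ∈ W, ∀ u, (P.opB g k u, P.insB g k (uncurry (funTableB ρ EB g)) u) ∈ P.Base k g u)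
    (hlip : P.toStepModel.DataLipschitz W κ Λ ρ₀) (hdA : DecayBound EA W EA₀ κ) (hdB : DecayBound EB W E₀ κ)
    (hop : ∀ k, ∀ g ∈ W, ∀ u : 𝒰, ‖P.opA g k u - P.opB g k u‖ ≤ δ * θ ^ k * P.rOp k)
    (hinsRate : ∀ k, ∀ g ∈ W, ∀ (t : C.Dom × 𝒰 → ℝ), (∀ Y u, |t (Y, u)| ≤ E₀ * Real.exp (-(κ * C.d Y))) →
      ∀ u, ‖P.insA g k t u - P.insB g k t u‖ ≤ δ' * θ ^ k * P.rHist k)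
    (hins : ∀ k, ∀ g ∈ W, ∀ (t : C.Dom × 𝒰 → ℝ) (u : 𝒰), P.insA g k t u = insAtOfChannel (pieceChannel Pc) out g k t u)
    (hsrc : SrcScale Pc) (hPiece : PieceBound Pc κ κ₁ d0 Kp (ellPrinted L)) (hLev : LevelCounts Pc κ κ₁ O1 L (ellPrinted L))
    (hKp : ∀ k y, 0 ≤ Kp k y) (hO1 : 0 ≤ O1) (hwt : ∀ k u i, weightOf Pc κ₁ d0 O1 Kp k (out u i) ≤ P.rHist (k + 1) * F.wt i)
    (hΛ : 0 ≤ Λ) (hδ : 0 ≤ δ + δ') (hθ : 0 ≤ θ) (hθθ' : θ ≤ θ') (hθ'1 : θ' ≤ 1)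
    (hnear : (δ + δ') * θ ^ k₀ + (6 * L) ^ 4 * (EA₀ + E₀) / (1 - L⁻¹) ≤ ρ₀) (hB : 0 ≤ B)
    (hfirst : ∀ k < k₀, EA₀ + E₀ ≤ B * θ ^ k) (hsmall : Λ < (θ' - L⁻¹) / (6 * L) ^ 4) :
    NE5 EA EB W κ θ' ((Λ * (δ + δ') + B) * (θ' - L⁻¹) / (θ' - (L⁻¹ + Λ * (6 * L) ^ 4))) :=
  ne5_of_ne5_lift hρ (OutputRateCount124.ne5_at_of_stepModel_lip_count124_nat P.toStepModel hL
    (P.representsA_of_pointwise hbdA hrA) (P.representsB_of_pointwise hbdB hrB) (P.inBase_of_pointwise hbdB hbase) hlip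
    (decayBound_liftA_of ρ hdA) (decayBound_liftB_of ρ hdB) (P.operatorRate_of_pointwise hop) (P.insertionRate_of_pointwise hinsRate)
    (insertionDampedNat_of_insAt_piece P hins hsrc hL hPiece hLev hKp hO1 hwt) hΛ hδ hθ hθθ' hθ'1 hnear hB hfirst hsmall)

end Piece

/-! ## §3 Toy over the infinite chart `ℕ`: non-vacuity of part 1 and the located design fact, kernel-checked -/

section Toy

/-- [folklore] Toy frame over the kernel's `toyCarriers` (domains = creation steps): one entry per domain, unit level formats. -/
abbrev toyFrame : HistFrame toyCarriers where
  Idx := ℕ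
  dom n := n
  wt _ := 1
  wt_pos _ := one_pos

/-- [folklore] Toy channel on `ℕ`-indexed background families: at step `k` the output index `(n, u)` reads the family AT the background
`u` and the domain `n`, for `n ≤ k` (a channel that reads the term as a function of the background, near the output's own point). -/
def toyChannel : ℕ → (ℕ → ℝ) → (ℕ → toyCarriers.Dom → ℝ) → ℕ × ℕ → ℝ := fun k _ H y => if y.1 ≤ k then H y.2 y.1 else 0

/-- [folklore] Toy output-index map: the entry `n` of the history at the chart point `u` reads the output index `(n, u)`. -/
def toyOut : ℕ → toyFrame.Idx → ℕ × ℕ := fun u n => (n, u)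

/-- [folklore] The toy channel is additive on all families. -/
theorem toyChannel_additive : ChannelAdditive (Set.univ : Set (ℕ → toyCarriers.Dom → ℝ)) toyChannel := by
  intro k s H₁ _ H₂ _ y
  show (if y.1 ≤ k then (H₁ - H₂) y.2 y.1 else 0) = (if y.1 ≤ k then H₁ y.2 y.1 else 0) - (if y.1 ≤ k then H₂ y.2 y.1 else 0)
  by_cases h : y.1 ≤ k
  · rw [if_pos h, if_pos h, if_pos h]; rfl
  · rw [if_neg h, if_neg h, if_neg h, sub_zero]

/-- [folklore] The toy channel is local (reads only the creation steps `≤ k`). -/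
theorem toyChannel_local : ChannelLocal (Set.univ : Set (ℕ → toyCarriers.Dom → ℝ)) toyChannel := by
  intro k s H _ y
  show (if y.1 ≤ k then H y.2 y.1 else 0) = if y.1 ≤ k then (if y.1 ≤ k then H y.2 y.1 else 0) else 0
  by_cases h : y.1 ≤ k
  · rw [if_pos h, if_pos h]
  · rw [if_neg h, if_neg h]

/-- [folklore] … hence has the step-sum structure on all families. -/
theorem toyChannel_stepSum : ChannelStepSum (Set.univ : Set (ℕ → toyCarriers.Dom → ℝ)) toyChannel :=
  channelStepSum_of_local admRestrict_univ toyChannel_additive toyChannel_local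

/-- [folklore] The toy channel's size binder: unit weights, unit profile, `κ = 0`. -/
theorem toyChannel_size :
    ChannelSizeAtStepNN (Set.univ : Set (ℕ → toyCarriers.Dom → ℝ)) toyChannel 0 (fun _ _ => 1) (fun _ _ => 1) := by
  intro k j _ s H _ hsupp N hN hbd y
  show |if y.1 ≤ k then H y.2 y.1 else 0| ≤ 1 * (1 * N)
  rw [one_mul, one_mul]
  by_cases h : y.1 ≤ k
  · rw [if_pos h]
    by_cases hy : toyCarriers.scale y.1 = j
    · simpa using hbd y.2 y.1 hy
    · rw [hsupp y.2 y.1 hy, abs_zero]; exact hN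
  · rw [if_neg h, abs_zero]; exact hN

/-- [folklore] DATA: toy per-background slots over the INFINITE chart `ℕ` whose two insertions ARE the toy channel insertion (output
functional and operators trivial, every datum admissible, unit margins). -/
def toySlots : PointwiseSlots toyCarriers ℕ ℂ (Hist toyFrame) where
  Out _ _ _ _ := 0
  opA _ _ _ := 0
  opB _ _ _ := 0
  insA g k t u := insAtOfChannel toyChannel toyOut g k t u
  insB g k t u := insAtOfChannel toyChannel toyOut g k t u
  Base _ _ _ := Set.univ
  rOp _ := 1
  rHist _ := 1
  rOp_pos _ := one_pos
  rHist_pos _ := one_pos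
  opA_bdd _ _ := ⟨0, by rintro _ ⟨u, rfl⟩; simp⟩
  opB_bdd _ _ := ⟨0, by rintro _ ⟨u, rfl⟩; simp⟩

/-- [folklore] **NON-VACUITY OF PART 1**: the toy's hypotheses hold jointly and MI-3a of its family model over `paramCarriers toyCarriers ℕ`
is DISCHARGED by `insertionDampedNat_of_insAt` (`κ = 0`, `c = 1`, `ω = 1`). -/
theorem toySlots_insertionDampedNat : toySlots.toStepModel.InsertionDampedNat (Set.univ : Set (ℕ → ℝ)) 0 1 1 :=
  insertionDampedNat_of_insAt toySlots (fun _ _ _ _ _ => rfl) toyChannel_additive toyChannel_stepSum toyChannel_size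
    (fun _ _ _ => zero_le_one) (fun _ _ _ => by show (1 : ℝ) ≤ 1 * 1; rw [mul_one]) (fun k j _ => by rw [one_pow, mul_one])
    zero_le_one zero_le_one

/-- [folklore] At step `1` the toy channel entries of ANY table at the chart point `u` are level-bounded (only the entry `0` is read). -/
theorem toy_entries_bdd (g : ℕ → ℝ) (t : toyCarriers.Dom × ℕ → ℝ) (u : ℕ) :
    ∃ μ : ℝ, ∀ n, ‖chanEntries (F := toyFrame) toyChannel toyOut 0 g t u n‖ ≤ μ * toyFrame.wt n := by
  refine ⟨|t ((0 : ℕ), u)|, fun n => ?_⟩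
  show ‖(((if n ≤ 0 then t (n, u) else 0 : ℝ)) : ℂ)‖ ≤ |t ((0 : ℕ), u)| * 1
  rw [Complex.norm_real, Real.norm_eq_abs, mul_one]
  by_cases h : n ≤ 0
  · rw [if_pos h, Nat.le_zero.1 h]
  · rw [if_neg h, abs_zero]; exact abs_nonneg _

/-- [folklore] **PER CHART POINT THE READING IS FAITHFUL**: at step `1` the inserted history of ANY table `t` at the chart point `u` has
norm EXACTLY `|t (0, u)|` (its one entry read, `read_insAt_succ`). -/
theorem toy_norm_insAt_eq (g : ℕ → ℝ) (t : toyCarriers.Dom × ℕ → ℝ) (u : ℕ) :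
    ‖insAtOfChannel (F := toyFrame) toyChannel toyOut g 1 t u‖ = |t ((0 : ℕ), u)| := by
  have hread : ∀ n, toyFrame.read (insAtOfChannel (F := toyFrame) toyChannel toyOut g 1 t u) n =
      (((if n ≤ 0 then t (n, u) else 0 : ℝ)) : ℂ) := fun n =>
    read_insAt_succ (F := toyFrame) toyChannel toyOut (toy_entries_bdd g t u) n
  refine le_antisymm ((toyFrame.norm_le_iff_read _ (abs_nonneg _)).2 fun n => ?_) ?_
  · rw [hread n, Complex.norm_real, Real.norm_eq_abs]
    show |if n ≤ 0 then t (n, u) else 0| ≤ |t ((0 : ℕ), u)| * 1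
    rw [mul_one]
    by_cases h : n ≤ 0
    · rw [if_pos h, Nat.le_zero.1 h]
    · rw [if_neg h, abs_zero]; exact abs_nonneg _
  · have h1 := toyFrame.norm_read_le (insAtOfChannel (F := toyFrame) toyChannel toyOut g 1 t u) 0
    rw [hread 0, if_pos le_rfl, Complex.norm_real, Real.norm_eq_abs] at h1
    have hw : toyFrame.wt 0 = 1 := rfl
    rw [hw, one_mul] at h1
    exact h1

/-- [folklore] The inserted family of a table at step `1` is bounded over the chart iff `u ↦ |t (0, u)|` is. -/
theorem toy_bddAbove_iff (g : ℕ → ℝ) (t : toyCarriers.Dom × ℕ → ℝ) :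
    BddAbove (Set.range fun u => ‖insAtOfChannel (F := toyFrame) toyChannel toyOut g 1 t u‖) ↔
      BddAbove (Set.range fun u : ℕ => |t ((0 : ℕ), u)|) := by
  simp_rw [toy_norm_insAt_eq]

/-- [folklore] DATA: the chart-UNBOUNDED table — at every domain its value is the chart point. -/
def tBad : toyCarriers.Dom × ℕ → ℝ := fun p => (p.2 : ℝ)

/-- [folklore] DATA: the bounded (constant) table `1`. -/
def tOne : toyCarriers.Dom × ℕ → ℝ := fun _ => 1

/-- [folklore] A table whose entry-`0` values dominate the chart point is inserted as an UNBOUNDED family of faithful histories. -/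
theorem toy_not_bddAbove {g : ℕ → ℝ} {t : toyCarriers.Dom × ℕ → ℝ} (ht : ∀ u : ℕ, (u : ℝ) - 1 ≤ |t ((0 : ℕ), u)|) :
    ¬ BddAbove (Set.range fun u => ‖insAtOfChannel (F := toyFrame) toyChannel toyOut g 1 t u‖) := by
  rw [toy_bddAbove_iff]
  rintro ⟨M, hM⟩
  obtain ⟨u, hu⟩ := exists_nat_gt (M + 1)
  have h : |t ((0 : ℕ), u)| ≤ M := hM ⟨u, rfl⟩
  linarith [ht u]

/-- [folklore] **THE FAMILY MODEL INSERTS THE CHART-UNBOUNDED TABLE AS THE JUNK `0`** (`famOf_eq_zero`), although at every chart point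
its inserted history is faithful with norm `u` (`toy_norm_insAt_eq`). -/
theorem toy_model_insA_tBad (g : ℕ → ℝ) : toySlots.toStepModel.insA g PUnit.unit 1 tBad = 0 :=
  famOf_eq_zero (toy_not_bddAbove fun u => by show (u : ℝ) - 1 ≤ |(u : ℝ)|; rw [abs_of_nonneg u.cast_nonneg]; linarith)

/-- [folklore] **THE LOCATED DESIGN FACT, KERNEL-CHECKED: `¬ InsAffine` FOR A BY-CONSTRUCTION CHANNEL INSERTION OVER AN INFINITE CHART**
— the mixed-junk pair `tBad`, `tBad − tOne`: both are inserted as the junk `0` by the family model, while their difference `tOne` is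
inserted faithfully and differs from the insertion of `0` at the entry `0` of the chart point `0` (`1 ≠ 0`).  MI-3a nevertheless holds
(`toySlots_insertionDampedNat`): on Road D the channel road's socket is the inequality binder, not the all-tables identities. -/
theorem toy_not_insAffine : ¬ toySlots.toStepModel.InsAffine (Set.univ : Set (ℕ → ℝ)) := by
  intro haff
  have h := haff 1 (fun _ => 0) (Set.mem_univ _) PUnit.unit tBad (tBad - tOne)
  rw [sub_sub_cancel, toy_model_insA_tBad] at h
  have hBad' : toySlots.toStepModel.insA (fun _ => 0) PUnit.unit 1 (tBad - tOne) = 0 :=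
    famOf_eq_zero (toy_not_bddAbove fun u => by
      show (u : ℝ) - 1 ≤ |(u : ℝ) - 1|
      exact le_abs_self _)
  rw [hBad', sub_self, eq_comm, sub_eq_zero] at h
  -- `h : famOf (ins tOne) = famOf (ins 0)`; both families are bounded, read them at the chart point `0`, entry `0`
  have hb1 : BddAbove (Set.range fun u => ‖insAtOfChannel (F := toyFrame) toyChannel toyOut (fun _ => 0) 1 tOne u‖) :=
    (toy_bddAbove_iff _ _).2 ⟨1, by rintro _ ⟨u, rfl⟩; show |(1 : ℝ)| ≤ 1; rw [abs_one]⟩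
  have hb0 : BddAbove (Set.range fun u => ‖insAtOfChannel (F := toyFrame) toyChannel toyOut (fun _ => 0) 1 0 u‖) :=
    (toy_bddAbove_iff _ _).2 ⟨0, by rintro _ ⟨u, rfl⟩; show |(0 : ℝ)| ≤ 0; rw [abs_zero]⟩
  have h0 := congrArg (fun f : Fam ℕ (Hist toyFrame) => toyFrame.read (f 0) 0) h
  change toyFrame.read (famOf (insAtOfChannel (F := toyFrame) toyChannel toyOut (fun _ => 0) 1 tOne) 0) 0 =
    toyFrame.read (famOf (insAtOfChannel (F := toyFrame) toyChannel toyOut (fun _ => 0) 1 0) 0) 0 at h0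
  rw [famOf_apply hb1, famOf_apply hb0, read_insAt_succ (F := toyFrame) toyChannel toyOut (toy_entries_bdd _ tOne 0) 0,
    read_insAt_succ (F := toyFrame) toyChannel toyOut (toy_entries_bdd _ 0 0) 0] at h0
  have h1 := Complex.ofReal_injective h0
  norm_num [toyChannel, toyOut, tOne] at h1

/-- [folklore] **THE EXACT FAMILY-LEVEL READING FAILS** (the other half of D-ne5leaf06g12-1, kernel-checked): it is NOT the case that
every table's inserted family, read at a chart point and an entry, returns the channel output — at the chart-unbounded `tBad` the family
model holds the junk `0` (`toy_model_insA_tBad`) while the channel output at `(u, i) = (1, 0)` is `tBad (0, 1) = 1`. -/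
theorem toy_not_readsFamily (g : ℕ → ℝ) :
    ¬ ∀ (t : toyCarriers.Dom × ℕ → ℝ) (u : ℕ) (i : ℕ),
      toyFrame.read (toySlots.toStepModel.insA g PUnit.unit 1 t u) i = ((toyChannel 0 g (toBgFamily t) (toyOut u i) : ℝ) : ℂ) := by
  intro h
  have h1 := h tBad 1 0
  rw [toy_model_insA_tBad] at h1
  have h2 : toyFrame.read ((0 : Fam ℕ (Hist toyFrame)) 1) 0 = 0 := by simp [HistFrame.read]
  rw [h2] at h1
  have h3 := Complex.ofReal_injective (h1.symm.trans Complex.ofReal_zero.symm)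
  norm_num [toyChannel, toyOut, tBad] at h3

end Toy

end Summit.QuantumFields.BalabanUV.T4Continuum.InsertionChannelFamily

end
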